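import Literature.NumberTheory.EllipticCurves.Kato2004.IwasawaCohomology
import Literature.NumberTheory.GaloisRepresentations.ContinuousCorestrictionRelConj
import Literature.NumberTheory.GaloisRepresentations.AbsGaloisOuterConj
import Literature.NumberTheory.GaloisRepresentations.AbsIntegersEquiv
import HarnessLib

/-!
# Kato 2004 (Astérisque 295) §12.2 (12.2.1) / §13.8: the Iwasawa cohomology `𝐇¹_Γ(T_pW)` EXISTS as a
# `Λ = ℤ_p⟦X⟧`-module — discharge of the named fact `Kato2004.nonempty_iwasawaH1Data` (proofs only)

Topic `NumberTheory/EllipticCurves`, sub-directory `Kato2004` (namespace = path), sibling proof file of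
`IwasawaCohomology.lean` (statement file untouched).  Seat `bsd-potss-rkm` (prover, cell `bsd-potss`,
item stmt-BirchSwinnertonDyer-19196 `ReducibleKatoMember`, whose held child 19654
`PublishedInputIwasawaH1Data[T]` is the fact discharged here; the fact is also a K6 input).

## What is proved

`nonempty_iwasawaH1Data_holds : nonempty_iwasawaH1Data` — for every elliptic curve `W/ℚ`, prime `p`,
cyclotomic `κ : ZpExtension ℚ p` and topological generator `γ`, the hypothesis structure
`IwasawaH1Data W p κ γ` of `IwasawaCohomology.lean` is inhabited.  (The hypothesis `κ.IsCyclotomic`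
is not used: the construction works for every `ℤ_p`-extension.)

## The construction (Kato §12.2 "the inverse limit is taken with respect to trace maps";
Lang, *Cyclotomic Fields I and II*, Ch. 5 §1 Thm. 1.1 "`Λ = ℤ_p⟦X⟧ → lim← ℤ_p[X]/(h_n)` is an isomorphism")

* `H` := the norm-compatible integral families `(y_n)_n ∈ ∏_n H¹(ℤ_n[1/p], T_pW)`
  (`Kato2004.IsNormCompatible`), i.e. `lim←_n H¹(ℤ_n[1/p], T_pW)` written inside the product;
  `proj n` := the `n`-th coordinate (`proj_mem`, `cores_proj`, `proj_injective`, `proj_surjective`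
  are then tautologies).
* The `Λ`-action.  On the level `H¹(ℚ_n, T_pW)` the operator `θ_n = conj_γ` satisfies
  `θ_n^{p^n} = 1`, because `γ^{p^n} ∈ Gal(ℚ̄/ℚ_n)` and inner automorphisms act trivially on `H¹`
  (`conjMap_one_apply_of_mem`, `conjMap_mul_apply_one`; here `conjMap_toLinearMap_pow_eq_one`).
  Hence `X ↦ θ_n − 1` kills the DISTINGUISHED polynomial `ω_n = (X+1)^{p^n} − 1`
  (`isDistinguishedAt_omega`), and `ℤ_p⟦X⟧ → ℤ_p⟦X⟧/(ω_n) ≅ ℤ_p[X]/(ω_n) → End(H¹(ℚ_n, T_pW))`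
  (Weierstrass division, Mathlib `Polynomial.IsDistinguishedAt.algEquivQuotient`; Washington Prop. 7.2)
  is a ring homomorphism `ψ_n` with `ψ_n(f) = r(θ_n − 1)` for every polynomial `r ≡ f (mod ω_n)`
  (`exists_ringHom_of_pow_eq_one`).  NO topology on the levels and NO finiteness theorem is needed:
  the continuity of Kato's `Λ`-action is replaced by the algebraic fact `ω_n(θ_n − 1) = 0`.
* The levelwise actions restrict to `H`: they commute with the trace maps because the relative
  corestriction is `Γ_ℚ`-equivariant (`coresLe_conjMap`, file `ContinuousCorestrictionRelConj`) and
  `ω_n ∣ ω_{n+1}` (`span_omega_succ_le`, `map_aeval_apply_of_comp_eq`), and they preserve the integral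
  classes (`conjMap_mem_integralH1`: for `y ∈ U ∩ I_𝔓`, `(g·φ)(y) = g φ(g⁻¹ y g)` with
  `g⁻¹ y g ∈ U ∩ I_{g⁻¹𝔓}` — the cocycle-level argument of `coresLe_mem_integralH1`).
* `proj_T_smul` / `proj_C_smul`: `ψ_n(X) = θ_n − 1 = conj_γ − 1` and `ψ_n(C c) = c`.

Everything here is proved; no definition (the datum is built inside the proof), no named fact, no
`instance`, no notation.  HONEST FRAMING: a CONSTRUCTION fact with no arithmetic content (as announced
in the docstring of `nonempty_iwasawaH1Data`); it removes one named input from the trust base of the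
Kato-descent routes (K9 / K8-t′ child 19654; K6), nothing more; BSD is not advanced by it.

## References

* K. Kato, *p-adic Hodge theory and values of zeta functions of modular forms*, Astérisque 295 (2004):
  §8.2 and Lemma 8.5 (pp. 180–184), §12.2 (12.2.1) (p. 220), §13.8 (p. 228). [Kato2004Asterisque]
* S. Lang, *Cyclotomic Fields I and II*, GTM 121 (1990), Ch. 5 §1 Thm. 1.1 (`ℤ_p⟦Γ⟧ ≅ lim ℤ_p[X]/(h_n)
  ≅ ℤ_p⟦X⟧`, `h_n = (1+X)^{p^n} − 1` distinguished). [Lang1990]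
* L. C. Washington, *Introduction to Cyclotomic Fields*, 2nd ed. (1997), Prop. 7.2 (Weierstrass
  division), Thm. 7.1 (`Λ ≅ lim ℤ_p[Γ_n]`). [Washington1997]
* Tree: `Kato2004/IwasawaCohomology.lean` (`IwasawaH1Data`, `integralH1`, `layerCores`,
  `IsNormCompatible`), `Kato2004/IntegralH1Corestriction.lean` (pattern of `conjMap_mem_integralH1`),
  `GaloisRepresentations/EulerSystem.lean` (`conjMap_one_apply_of_mem`, `conjMap_mul_apply_one`),
  `IwasawaDualModule.lean` / `IwasawaSelmerDualProofs.lean` (the discrete-side analogue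
  `nonempty_selmerDualData_holds`).
-/

noncomputable section

open scoped NumberField Pointwise
open CategoryTheory Field IsDedekindDomain Polynomial
open Literature.NumberTheory.GaloisRepresentations Rat.HeightOneSpectrum
open Literature.NumberTheory.EllipticCurves.Kato2004.EulerSystemValues
open Literature.NumberTheory.EllipticCurves (subgroupInclusion subgroupInclusion_apply_coe
  subgroupConj subgroupConj_apply_coe)

namespace Literature.NumberTheory.EllipticCurves.Kato2004

namespace IwasawaH1Exists

/-! ## `conj` preserves the integral classes `H¹(O_F[1/p], T) ⊆ H¹(F, T)` (Kato §8.2) -/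

section Integral

variable {A : Type} [CommRing A] [TopologicalSpace A] {M : Type} [AddCommGroup M] [Module A M]
  [TopologicalSpace M] [IsTopologicalAddGroup M] [ContinuousSMul A M]

/-- **The `Γ_ℚ`-action preserves the integral classes.**  For `U ⊴ Γ_ℚ` normal, `g ∈ Γ_ℚ` and
`x ∈ H¹(ℤ_U[1/p], T) = integralH1 T p U`, also `g · x ∈ integralH1 T p U`: for `𝔓 ∣ v ≠ p` and
`y ∈ U ∩ I_𝔓`, `(g·φ)(y) = g φ(g⁻¹ y g)` with `g⁻¹ y g ∈ U ∩ I_{g⁻¹𝔓}` where `φ` is a coboundary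
`z ↦ z w − w`, so `(g·φ)(y) = y (g w) − g w` (Kato §8.2: `H¹(O_K[1/p], T)` is a `Gal`-submodule;
Leray for `j_*`). [cite: Kato2004Asterisque, §8.2 and Lemma 8.5 (pp. 180–184)] -/
theorem conjMap_mem_integralH1 (T : GaloisRep ℚ A M) (p : ℕ)
    (U : Subgroup (absoluteGaloisGroup ℚ)) [U.Normal] (g : absoluteGaloisGroup ℚ)
    {x : H1 T U} (hx : x ∈ integralH1 T p U) :
    conjMap T.toTopRep U g 1 x ∈ integralH1 T p U := by
  rw [mem_integralH1_iff] at hx ⊢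
  intro v hv 𝔓 h𝔓
  obtain ⟨φ, rfl⟩ := oneCocycleClass_surjective _ x
  have h0 := hx v hv _ (smul_mem_primesAbove h𝔓 g⁻¹)
  rw [resLe_oneCocycleClass, oneCocycleClass_eq_zero_iff] at h0
  obtain ⟨w, hw⟩ := h0
  rw [conjMap_oneCocycleClass, resLe_oneCocycleClass, oneCocycleClass_eq_zero_iff]
  refine ⟨T.toTopRep.ρ g w, fun y ↦ ?_⟩
  have hyI : (y : absoluteGaloisGroup ℚ) ∈ 𝔓.inertia (absoluteGaloisGroup ℚ) := y.2.2
  have hyU : (y : absoluteGaloisGroup ℚ) ∈ U := y.2.1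
  have hmemI : g⁻¹ * (y : absoluteGaloisGroup ℚ) * g ∈
      (g⁻¹ • 𝔓).inertia (absoluteGaloisGroup ℚ) := by
    have := (Ideal.conj_mem_inertia_smul_iff 𝔓 g⁻¹ (y : absoluteGaloisGroup ℚ)).mpr hyI
    simpa using this
  have hmemU : g⁻¹ * (y : absoluteGaloisGroup ℚ) * g ∈ U :=
    Subgroup.Normal.conj_mem' inferInstance _ hyU g
  have key : φ.1 (subgroupInclusion inf_le_left
        ⟨g⁻¹ * (y : absoluteGaloisGroup ℚ) * g, hmemU, hmemI⟩) =
      T.toTopRep.ρ (g⁻¹ * (y : absoluteGaloisGroup ℚ) * g) w - w :=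
    hw ⟨g⁻¹ * (y : absoluteGaloisGroup ℚ) * g, hmemU, hmemI⟩
  rw [contOneCocycles.pullback_apply, TopRep.hom_ofHom]
  change (contOneCocycles.pullback (subgroupConj U g) (conjRepHom T.toTopRep U g) φ).1
      (subgroupInclusion (inf_le_left : U ⊓ 𝔓.inertia (absoluteGaloisGroup ℚ) ≤ U) y) = _
  rw [conj_pullback_apply]
  have harg : subgroupConj U g
      (subgroupInclusion (inf_le_left : U ⊓ 𝔓.inertia (absoluteGaloisGroup ℚ) ≤ U) y) =
      subgroupInclusion inf_le_left ⟨g⁻¹ * (y : absoluteGaloisGroup ℚ) * g, hmemU, hmemI⟩ :=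
    Subtype.ext rfl
  rw [harg, key, map_sub, subgroupRep_ρ_apply, ← ρ_mul_apply,
    show g * (g⁻¹ * (y : absoluteGaloisGroup ℚ) * g) = (y : absoluteGaloisGroup ℚ) * g by group,
    ρ_mul_apply]

end Integral

/-! ## `Λ = ℤ_p⟦X⟧` acting through a finite level: Weierstrass division by `ω_n` -/

section Algebra

variable (p : ℕ) [Fact p.Prime]

/-- `(X + 1)^m` is monic of degree `m`. [folklore] -/
private theorem monic_X_add_one_pow (m : ℕ) :
    ((X + 1 : ℤ_[p][X]) ^ m).Monic ∧ ((X + 1 : ℤ_[p][X]) ^ m).natDegree = m := by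
  rw [show (X + 1 : ℤ_[p][X]) = X + C 1 by rw [C_1]]
  exact ⟨(monic_X_add_C 1).pow m,
    by rw [(monic_X_add_C 1).natDegree_pow, natDegree_X_add_C, mul_one]⟩

/-- `ω_m = (X + 1)^m − 1` is monic of degree `m` for `m ≠ 0`. [folklore] -/
private theorem monic_omega {m : ℕ} (hm : m ≠ 0) :
    ((X + 1 : ℤ_[p][X]) ^ m - 1).Monic ∧ ((X + 1 : ℤ_[p][X]) ^ m - 1).natDegree = m := by
  obtain ⟨hmon, hdeg⟩ := monic_X_add_one_pow p m
  have hlt : (1 : ℤ_[p][X]).degree < ((X + 1 : ℤ_[p][X]) ^ m).degree := by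
    rw [degree_one, degree_eq_natDegree (Monic.ne_zero hmon), hdeg]
    exact_mod_cast Nat.pos_of_ne_zero hm
  refine ⟨hmon.sub_of_left hlt, ?_⟩
  rw [natDegree_sub_eq_left_of_natDegree_lt
    (by rw [natDegree_one, hdeg]; exact Nat.pos_of_ne_zero hm), hdeg]

/-- **`ω_n = (X + 1)^{p^n} − 1` is a distinguished polynomial** over `ℤ_p`: monic, constant
coefficient `0`, and the other non-leading coefficients `C(p^n, k)`, `0 < k < p^n`, divisible by `p`
(Lang, *Cyclotomic Fields I and II*, Ch. 5 §1: "such a polynomial is called distinguished";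
Washington §7.1). [cite: Lang1990, Ch. 5 §1 (p. 124)] [cite: Washington1997, §7.1] -/
theorem isDistinguishedAt_omega (n : ℕ) :
    ((X + 1 : ℤ_[p][X]) ^ p ^ n - 1).IsDistinguishedAt (IsLocalRing.maximalIdeal ℤ_[p]) := by
  have hp : p.Prime := Fact.out
  have hm : p ^ n ≠ 0 := pow_ne_zero n hp.ne_zero
  obtain ⟨hmon, hdeg⟩ := monic_omega p hm
  refine ⟨⟨fun {k} hk => ?_⟩, hmon⟩
  rw [hdeg] at hk
  rw [coeff_sub, coeff_X_add_one_pow, coeff_one]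
  rcases Nat.eq_zero_or_pos k with rfl | hk0
  · simp
  · rw [if_neg hk0.ne', sub_zero, PadicInt.maximalIdeal_eq_span_p, Ideal.mem_span_singleton]
    exact_mod_cast Nat.cast_dvd_cast (hp.dvd_choose_pow hk0.ne' hk.ne)

/-- `ω_n ∣ ω_{n+1}` in `ℤ_p[X]` (`(X+1)^{p^{n+1}} − 1 = Y^p − 1`, `Y = (X+1)^{p^n}`; the transition
maps of `lim← ℤ_p[X]/(ω_n)`, Lang Ch. 5 §1 / Washington Thm. 7.1). [cite: Lang1990, Ch. 5 §1 Thm. 1.1]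
[cite: Washington1997, Thm. 7.1] -/
theorem omega_dvd_omega_succ (n : ℕ) :
    ((X + 1 : ℤ_[p][X]) ^ p ^ n - 1) ∣ ((X + 1 : ℤ_[p][X]) ^ p ^ (n + 1) - 1) := by
  have := sub_dvd_pow_sub_pow ((X + 1 : ℤ_[p][X]) ^ p ^ n) 1 p
  rwa [one_pow, ← pow_mul, ← pow_succ] at this

/-- The ideals `(ω_n) ⊆ Λ = ℤ_p⟦X⟧` decrease: `(ω_{n+1}) ≤ (ω_n)` (transition maps of
`Λ ≅ lim← Λ/(ω_n)`). [cite: Lang1990, Ch. 5 §1 Thm. 1.1] [cite: Washington1997, Thm. 7.1] -/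
theorem span_omega_succ_le (n : ℕ) :
    Ideal.span {(((X + 1 : ℤ_[p][X]) ^ p ^ (n + 1) - 1 : ℤ_[p][X]) : PowerSeries ℤ_[p])} ≤
      Ideal.span {(((X + 1 : ℤ_[p][X]) ^ p ^ n - 1 : ℤ_[p][X]) : PowerSeries ℤ_[p])} := by
  apply Ideal.span_singleton_le_span_singleton.mpr
  exact map_dvd (Polynomial.coeToPowerSeries.ringHom (R := ℤ_[p])) (omega_dvd_omega_succ p n)

/-- **Weierstrass division by `ω_n`**: every power series `f ∈ ℤ_p⟦X⟧` is congruent modulo `ω_n`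
to a polynomial (Washington Prop. 7.2; Mathlib `Polynomial.IsDistinguishedAt.algEquivQuotient`).
[cite: Washington1997, Prop. 7.2] [cite: Lang1990, Ch. 5 §2 Thm. 2.1] -/
theorem exists_polynomial_sub_coe_mem_span (n : ℕ) (f : PowerSeries ℤ_[p]) :
    ∃ r : ℤ_[p][X], f - (r : PowerSeries ℤ_[p]) ∈
      Ideal.span {(((X + 1 : ℤ_[p][X]) ^ p ^ n - 1 : ℤ_[p][X]) : PowerSeries ℤ_[p])} := by
  set e := (isDistinguishedAt_omega p n).algEquivQuotient with he
  obtain ⟨r, hr⟩ := Ideal.Quotient.mk_surjective (e.symm (Ideal.Quotient.mk _ f))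
  refine ⟨r, ?_⟩
  rw [← Ideal.Quotient.mk_eq_mk_iff_sub_mem]
  have h2 : e (Ideal.Quotient.mk _ r) = Ideal.Quotient.mk _ (r : PowerSeries ℤ_[p]) := by
    simp [he, Polynomial.IsDistinguishedAt.algEquivQuotient]
  rw [← h2, hr, AlgEquiv.apply_symm_apply]

variable {M : Type*} [AddCommGroup M] [Module ℤ_[p] M]

/-- `ω_n(θ − 1) = θ^{p^n} − 1`. [folklore] -/
private theorem aeval_sub_one_omega (θ : Module.End ℤ_[p] M) (n : ℕ) :
    aeval (θ - 1) ((X + 1 : ℤ_[p][X]) ^ p ^ n - 1) = θ ^ p ^ n - 1 := by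
  simp [map_sub, map_pow, map_add, aeval_X, sub_add_cancel]

/-- **The `Λ = ℤ_p⟦X⟧`-action through a finite level.**  If an endomorphism `θ` of a `ℤ_p`-module
`M` satisfies `θ^{p^n} = 1`, then `X ↦ θ − 1` extends (uniquely) to a ring homomorphism
`ψ : ℤ_p⟦X⟧ → End(M)` factoring through `ℤ_p⟦X⟧/(ω_n) ≅ ℤ_p[X]/(ω_n)` (Weierstrass division by the
distinguished polynomial `ω_n = (X+1)^{p^n} − 1`): `ψ(f) = r(θ − 1)` for every polynomial `r ≡ f
(mod ω_n)` (Lang, *Cyclotomic Fields*, Ch. 5 §1 Thm. 1.1: `Λ ≅ lim← ℤ_p[X]/(ω_n)`, the `n`-th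
term; Washington Thm. 7.1 / Prop. 7.2). [cite: Lang1990, Ch. 5 §1 Thm. 1.1]
[cite: Washington1997, Thm. 7.1 and Prop. 7.2] -/
theorem exists_ringHom_of_pow_eq_one (θ : Module.End ℤ_[p] M) (n : ℕ) (hθ : θ ^ p ^ n = 1) :
    ∃ ψ : PowerSeries ℤ_[p] →+* Module.End ℤ_[p] M,
      ∀ (f : PowerSeries ℤ_[p]) (r : ℤ_[p][X]),
        f - (r : PowerSeries ℤ_[p]) ∈
          Ideal.span {(((X + 1 : ℤ_[p][X]) ^ p ^ n - 1 : ℤ_[p][X]) : PowerSeries ℤ_[p])} →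
        ψ f = aeval (θ - 1) r := by
  set ω : ℤ_[p][X] := (X + 1 : ℤ_[p][X]) ^ p ^ n - 1 with hω
  set e := (isDistinguishedAt_omega p n).algEquivQuotient with he
  have hkill : ∀ a ∈ Ideal.span {ω},
      (aeval (θ - 1) : ℤ_[p][X] →ₐ[ℤ_[p]] Module.End ℤ_[p] M) a = 0 := fun a ha ↦ by
    obtain ⟨b, rfl⟩ := Ideal.mem_span_singleton'.mp ha
    rw [map_mul, hω, aeval_sub_one_omega, hθ, sub_self, mul_zero]
  let L : ℤ_[p][X] ⧸ Ideal.span {ω} →+* Module.End ℤ_[p] M :=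
    Ideal.Quotient.lift (Ideal.span {ω}) (aeval (θ - 1)).toRingHom hkill
  refine ⟨(L.comp e.symm.toRingEquiv.toRingHom).comp (Ideal.Quotient.mk _), fun f r hfr => ?_⟩
  have h1 : Ideal.Quotient.mk (Ideal.span {(ω : PowerSeries ℤ_[p])}) f =
      Ideal.Quotient.mk _ (r : PowerSeries ℤ_[p]) :=
    (Ideal.Quotient.mk_eq_mk_iff_sub_mem _ _).mpr hfr
  have h2 : e (Ideal.Quotient.mk _ r) = Ideal.Quotient.mk _ (r : PowerSeries ℤ_[p]) := by
    simp [he, Polynomial.IsDistinguishedAt.algEquivQuotient]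
  rw [RingHom.comp_apply, RingHom.comp_apply, h1, ← h2]
  change L (e.symm (e (Ideal.Quotient.mk _ r))) = _
  rw [AlgEquiv.symm_apply_apply]
  exact Ideal.Quotient.lift_mk _ _ _

/-- A linear map intertwining two endomorphisms intertwines the polynomials in them. [folklore] -/
private theorem map_aeval_apply_of_comp_eq {M' : Type*} [AddCommGroup M'] [Module ℤ_[p] M']
    (g : M →ₗ[ℤ_[p]] M') (a : Module.End ℤ_[p] M) (b : Module.End ℤ_[p] M')
    (h : g ∘ₗ a = b ∘ₗ g) (r : ℤ_[p][X]) (m : M) : g (aeval a r m) = aeval b r (g m) := by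
  induction r using Polynomial.induction_on generalizing m with
  | C c => simp
  | add f₁ f₂ h₁ h₂ => simp [h₁, h₂]
  | monomial k c hk =>
    have hc : ∀ m, g (a m) = b (g m) := fun m => by simpa using LinearMap.congr_fun h m
    rw [pow_succ, ← mul_assoc]
    conv_rhs => rw [map_mul, Module.End.mul_apply, aeval_X]
    conv_lhs => rw [map_mul, Module.End.mul_apply, aeval_X]
    rw [hk, hc]


end Algebra

/-! ## Assembly: the datum `IwasawaH1Data W p κ γ` on the norm-compatible integral families -/

section Assembly

variable (W : WeierstrassCurve ℚ) [W.IsElliptic] (p : ℕ) [Fact p.Prime]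
  [ContinuousSMul ℤ_[p] (W.tateModule p)] (κ : ZpExtension ℚ p) (γ : absoluteGaloisGroup ℚ)

/-- `γ^{pⁿ} ∈ κ⁻¹(pⁿℤ_p) = Gal(ℚ̄/ℚ_n)` for `γ` with `κ γ = 1` (local copy of
`ZpExtension.pow_mem_layerSubgroup` of `IwasawaSelmerControlKernelProofs`, not imported to keep this
file light). [folklore] -/
private theorem pow_mem_layerSubgroup' {γ : absoluteGaloisGroup ℚ} (hγ : κ.IsTopGenerator γ) (n : ℕ) :
    γ ^ p ^ n ∈ κ.layerSubgroup n := by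
  have hγ' : κ γ = Multiplicative.ofAdd 1 := hγ
  rw [ZpExtension.mem_layerSubgroup, map_pow, hγ', ← ofAdd_nsmul, toAdd_ofAdd, nsmul_eq_mul,
    mul_one, Nat.cast_pow]

/-- The trace map `Cor : H¹(ℚ_{n+1}, T) → H¹(ℚ_n, T)` commutes with the action of `Γ_ℚ`
(`coresLe_conjMap` for the normal layers `Γ_{n+1} ≤ Γ_n`).
[cite: Kato2004Asterisque, §12.2 (p. 220)] -/
theorem layerCores_conjMap (n : ℕ) (g : absoluteGaloisGroup ℚ)
    (y : H1 (tateRep W p) (κ.layerSubgroup (n + 1))) :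
    layerCores (tateRep W p) κ n (conjMap (tateRep W p).toTopRep (κ.layerSubgroup (n + 1)) g 1 y) =
      conjMap (tateRep W p).toTopRep (κ.layerSubgroup n) g 1 (layerCores (tateRep W p) κ n y) := by
  letI : (κ.layerSubgroup (n + 1)).FiniteIndex :=
    finiteIndex_of_isOpen_of_compactSpace _ (κ.isOpen_layerSubgroup (n + 1))
  letI : Fintype (κ.layerSubgroup n ⧸ (κ.layerSubgroup (n + 1)).subgroupOf (κ.layerSubgroup n)) :=
    Fintype.ofFinite _
  have h := coresLe_conjMap (tateRep W p).toTopRep (κ.layerSubgroup_antitone (Nat.le_succ n))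
    (κ.isOpen_layerSubgroup (n + 1)) g y
  unfold layerCores
  convert h using 2

/-- **Kato 2004 §12.2 (12.2.1) / §13.8 (p. 228): the Iwasawa cohomology `𝐇¹_Γ(T_pW)` EXISTS as a
`Λ = ℤ_p⟦X⟧`-module — discharge of the named fact `nonempty_iwasawaH1Data`.**  Construction: `H` is
the set of norm-compatible integral families `(y_n)_n ∈ ∏_n H¹(ℤ_n[1/p], T_pW)` (the inverse limit
along the trace maps, written inside the product), `proj n` the `n`-th coordinate.  The `Λ`-module
structure: on the `n`-th level `Λ` acts through `Λ/(ω_n) ≅ ℤ_p[X]/(ω_n)` (Weierstrass division by the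
distinguished polynomial `ω_n = (X+1)^{p^n} − 1`; Lang, *Cyclotomic Fields*, Ch. 5 Thm. 1.1
`Λ ≅ lim← ℤ_p[X]/(ω_n)`), `X ↦ conj_γ − 1`, which is well defined because `γ^{p^n} ∈ Gal(ℚ̄/ℚ_n)`
acts trivially on `H¹(ℚ_n, T_pW)` (inner automorphisms), i.e. `ω_n(conj_γ − 1) = 0`; the levelwise
actions are compatible with the trace maps (`Cor` is `Γ_ℚ`-equivariant, `coresLe_conjMap`) and
preserve integrality (`conjMap_mem_integralH1`), so they restrict to `H`.  No topology on the
levels and no finiteness theorem is used.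
[cite: Kato2004Asterisque, §12.2 (12.2.1) (p. 220) and §13.8 (p. 228)] -/
theorem nonempty_iwasawaH1Data_holds : nonempty_iwasawaH1Data := by
  intro W _ p _ _ κ γ _hκ hγ
  -- the level operators `θ_n = conj_γ` on `H¹(ℚ_n, T_pW)` and `θ_n^{p^n} = 1`
  let θ : ∀ n, Module.End ℤ_[p] (H1 (tateRep W p) (κ.layerSubgroup n)) := fun n ↦
    (conjMap (tateRep W p).toTopRep (κ.layerSubgroup n) γ 1).hom.toLinearMap
  have hθ : ∀ n (c : H1 (tateRep W p) (κ.layerSubgroup n)),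
      θ n c = conjMap (tateRep W p).toTopRep (κ.layerSubgroup n) γ 1 c := fun _ _ ↦ rfl
  have hθpow : ∀ n, θ n ^ p ^ n = 1 := fun n ↦
    conjMap_toLinearMap_pow_eq_one (tateRep W p).toTopRep (κ.layerSubgroup n)
      (pow_mem_layerSubgroup' p κ hγ n)
  -- the `Λ`-action on each level through `Λ/(ω_n) ≅ ℤ_p[X]/(ω_n)`
  choose ψ hψ using fun n ↦ exists_ringHom_of_pow_eq_one p (θ n) n (hθpow n)
  letI inst : ∀ n, Module (IwasawaAlgebra p) (H1 (tateRep W p) (κ.layerSubgroup n)) :=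
    fun n ↦ Module.compHom _ (ψ n)
  have smul_def : ∀ (n : ℕ) (f : IwasawaAlgebra p) (m : H1 (tateRep W p) (κ.layerSubgroup n)),
      f • m = ψ n f m := fun _ _ _ ↦ rfl
  -- value of the action on polynomials, on `X`, on constants
  have hψcoe : ∀ (n : ℕ) (r : ℤ_[p][X]), ψ n (r : PowerSeries ℤ_[p]) = aeval (θ n - 1) r :=
    fun n r ↦ hψ n _ r (by rw [sub_self]; exact Submodule.zero_mem _)
  have hψX : ∀ n, ψ n (PowerSeries.X : IwasawaAlgebra p) = θ n - 1 := fun n ↦ by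
    rw [← Polynomial.coe_X, hψcoe, aeval_X]
  have hψC : ∀ (n : ℕ) (c : ℤ_[p]), ψ n (PowerSeries.C c : IwasawaAlgebra p) =
      algebraMap ℤ_[p] _ c := fun n c ↦ by
    rw [← Polynomial.coe_C, hψcoe, aeval_C]
  -- `integralH1` is stable under `θ_n - 1`, hence under the action
  have hstable : ∀ n, integralH1 (tateRep W p) p (κ.layerSubgroup n) ≤
      (integralH1 (tateRep W p) p (κ.layerSubgroup n)).comap (θ n - 1) := by
    intro n m hm
    rw [Submodule.mem_comap, LinearMap.sub_apply, Module.End.one_apply, hθ]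
    exact Submodule.sub_mem _ (conjMap_mem_integralH1 (tateRep W p) p _ γ hm) hm
  -- compatibility of `θ_n − 1` with the trace maps
  have hcomm : ∀ n, (layerCores (tateRep W p) κ n) ∘ₗ (θ (n + 1) - 1) =
      (θ n - 1) ∘ₗ (layerCores (tateRep W p) κ n) := by
    intro n
    refine LinearMap.ext fun y ↦ ?_
    simp only [LinearMap.coe_comp, Function.comp_apply, LinearMap.sub_apply, Module.End.one_apply,
      map_sub, hθ, layerCores_conjMap]
  -- the `Λ`-submodule of norm-compatible integral families
  let N : Submodule (IwasawaAlgebra p) (∀ n : ℕ, H1 (tateRep W p) (κ.layerSubgroup n)) :=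
    { carrier := {y | IsNormCompatible (tateRep W p) κ y}
      zero_mem' := (normCompatible (tateRep W p) κ).zero_mem
      add_mem' := fun ha hb ↦ (normCompatible (tateRep W p) κ).add_mem ha hb
      smul_mem' := fun f y hy ↦ by
        refine ⟨fun n ↦ ?_, fun n ↦ ?_⟩
        · obtain ⟨r, hr⟩ := exists_polynomial_sub_coe_mem_span p n f
          rw [Pi.smul_apply, smul_def, hψ n f r hr]
          exact aeval_apply_smul_mem_of_le_comap (hy.1 n) r _ (hstable n)
        · obtain ⟨r, hr⟩ := exists_polynomial_sub_coe_mem_span p (n + 1) f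
          rw [Pi.smul_apply, Pi.smul_apply, smul_def, smul_def, hψ (n + 1) f r hr,
            hψ n f r (span_omega_succ_le p n hr),
            map_aeval_apply_of_comp_eq p _ _ _ (hcomm n), hy.2 n] }
  refine ⟨{
    H := N
    proj := fun n ↦
      { toFun := fun x ↦ (x : ∀ n : ℕ, H1 (tateRep W p) (κ.layerSubgroup n)) n
        map_zero' := rfl
        map_add' := fun _ _ ↦ rfl }
    proj_mem := fun n x ↦ x.2.1 n
    cores_proj := fun n x ↦ x.2.2 n
    proj_injective := fun x hx ↦ Subtype.ext (funext hx)
    proj_surjective := fun y hy ↦ ⟨⟨y, hy⟩, fun _ ↦ rfl⟩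
    proj_T_smul := fun n x ↦ ?_
    proj_C_smul := fun c n x ↦ ?_ }⟩
  · change ψ n PowerSeries.X ((x : ∀ n : ℕ, H1 (tateRep W p) (κ.layerSubgroup n)) n) = _
    rw [hψX, LinearMap.sub_apply, Module.End.one_apply, hθ]
    rfl
  · change ψ n (PowerSeries.C c) ((x : ∀ n : ℕ, H1 (tateRep W p) (κ.layerSubgroup n)) n) = _
    rw [hψC, Module.algebraMap_end_apply]
    rfl

end Assembly

end IwasawaH1Exists

/-- **Kato 2004 §12.2 (12.2.1): `𝐇¹_Γ(T_pW)` exists** (root-namespace alias of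
`IwasawaH1Exists.nonempty_iwasawaH1Data_holds`, the `_holds` companion of the named fact
`nonempty_iwasawaH1Data`). [cite: Kato2004Asterisque, §12.2 (12.2.1) (p. 220) and §13.8 (p. 228)] -/
theorem nonempty_iwasawaH1Data_holds : nonempty_iwasawaH1Data :=
  IwasawaH1Exists.nonempty_iwasawaH1Data_holds

end Literature.NumberTheory.EllipticCurves.Kato2004

end
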